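import Summits.QuantumFields.BalabanUV.T4Continuum.Support.NE9PolydiscChain

/-!
# NE9PolydiscStepOffCentre — ROUTE R4♯-T «TRANSLATION-AWARE SP CHAIN», PIECE (T-a), PART 1∕2: the infinitesimal polydisc
# Schwarz–Pick lemma at the SHARP radius, the ONE-STEP lemma for an OFF-CENTRE image `B̄(c, ρ₄)` at an admissible rate `μ`,
# and the chain estimate on the unit ball of `ℓ^∞(A;ℂ)`
# (the OWNER t4-ne9-p1 generation 61's INTERFACE REQUEST NE9 «`NE9PolydiscChainOffCentre.chainLipschitz_of_holoMaps_offCentre`»,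
# cell journal l.29955 ∕ INBOX l.6154, on the crux refuter's PRICING-NE9 v10 §E (F-v10-4 ∕ Q-v10-1 «no obstruction»); cell
# `pub-balaban`, T4-DAG §2 node U3 ∕ §6 NE9; unit `b2b-balaban-t4-ne9-formalise-leaf-03`, generation 44; Summits-side NEW
# work on the R4♯ kernel `NE9PolydiscSchwarzPick` ∕ `NE9PolydiscChain` (p255292 ∕ p255595); nothing of any import modified,
# nothing printed asserted, no named fact, 0 `def`)

HONEST FRAMING (T4-DAG PAGE 1).  Rung (B)+1 of the FINITE-VOLUME T⁴ programme — NOT infinite volume, NOT a mass gap, NOT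
the Clay problem.  NE9 (`T4OutputRate.NE9` ∧ `FadingMemory`) is a cell NEW ESTIMATE, NOT PRINTED in [I] = CMP **109**, [II] =
CMP **116**, and NOT PROVED here or anywhere (spine PROVED 0∕9).  This file is generic several-complex-variables bookkeeping
on the polydisc `B_{ℓ^∞(A;ℂ)}`; no Bałaban object occurs.  A sharper RATE inside a conditional END is NOT progress on the
estimate.  HONEST DEPENDENCY (cell line, verbatim): continuum YM on T⁴ ⇐ BetaPertH ∧ nine spine estimates (0/9 proved);
BetaPertH ⇐ (D1) ∧ (D4) ∧ CAP+tail; G-an2-4 gates asym, D1 and NE2/3/4.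

WHAT (all kernel-checked, 0 sorry).
* §0 THE RATE INEQUALITY `(r₄² − ρ²)·r ≤ μ·r₄·(r² − (c̄ + ρ)²)` for all `ρ ∈ [0, r₄]` («`μ` is an ADMISSIBLE RATE for
  `(r, c̄, r₄)`»; the refuter's `λ*(c̄, r₄)` of PRICING-NE9 v10 (E10-1) is the least one): `rate_pos_unit ∕ rate_pos` (an
  admissible rate is positive), and THREE SUPPLIERS — `rateIneq_crude` (the closed form `μ₀ = r₄r∕(r² − (c̄ + r₄)²)`),
  `rateIneq_centred` (`c̄ = 0`, `r₄ = θr` ⇒ `μ = θ`: `NE9PolydiscChain`'s case), `rateIneq_of_quadTest` (the planner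
  `t4-ne9-idea-1` generation 9's QUADRATIC TEST `(λt′c̄)² ≤ (λt′(1−c̄²) − t′²)(1 − λt′)`, `λt′ < 1`, `t ≤ t′` — a `norm_num`
  certificate at rational letters; `pointwise_of_quadTest` is the planner's, verbatim).
* §1 `mul_norm_fderiv_apply_le` — `NE9PolydiscSchwarzPick.norm_fderiv_apply_le` in the SHARP radius-`s` form:
  `h : B(0,1) → B̄_𝔉(0,s)` holomorphic, `|v_α| ≤ C(1 − |x_α|²)` ⇒ `s·|π(Dh(x)v)| ≤ C·(s² − |π(h x)|²)` (the tree lemma at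
  `θ′ = 1` applied to `t⁻¹ • h`, then `t ↓ s`).
* §2 `norm_fderiv_apply_le_offCentre` — ONE STEP, OFF-CENTRE IMAGE: `f : B(0,1) → B̄(c, ρ₄)` holomorphic, `‖c‖ ≤ c̄`,
  `c̄ + ρ₄ < 1`, `μ` admissible for `(1, c̄, ρ₄)` ⇒ `|π(Df(x)v)| ≤ μ·C·(1 − |π(f x)|²)` — the refuter's
  «K(f z; Df·v) ≤ λ*·K(z; v)» (PRICING-NE9 v10 (E10-1)); `λ*` is the least admissible `μ`.
* §3 `norm_sub_le_of_holoChain_offCentre_unit` — THE CHAIN on the unit ball (`NE9PolydiscChain`'s structure (a)–(d) with §2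
  in the inductive step): composites of holomorphic `B(0,1) → B̄(c_n, ρ₄)`, `‖c_n‖ ≤ c̄`, `c̄ + ρ₄ ≤ θ < 1`, are
  `(1∕(1−θ²))·μⁿ`-Lipschitz on `B̄(0,θ)`.
PART 2 (`NE9PolydiscChainOffCentre`): radius `r`, any `𝔛 ≃ₗᵢ[ℂ] ℓ^∞(A;ℂ)`, the requested `chainLipschitz_of_holoMaps_offCentre`
and the ENDs.
DISGUISE TEST: no inequality of the series; no Bałaban object; 0 sorry; no named fact; nothing printed asserted.

References: [FV1980] T. Franzoni, E. Vesentini, *Holomorphic Maps and Invariant Distances*, North-Holland Math. Studies 40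
(1980), ch. IV–V (product property of the Carathéodory∕Kobayashi metric of the polydisc; holomorphic maps contract it);
[Harris1979] L. A. Harris, North-Holland Math. Studies 34 (1979) 345–406; [JarnickiPflug1993] M. Jarnicki, P. Pflug,
*Invariant Distances and Metrics in Complex Analysis* (1993), ch. 3.  TYPES ∕ loci only; nothing asserted.
-/

noncomputable section

namespace Summit.QuantumFields.BalabanUV.T4Continuum.NE9PolydiscStepOffCentre

open Metric Set Filter
open scoped Topology ENNReal
open Summit.QuantumFields.BalabanUV.T4Continuum.NE9PolydiscSchwarzPick (evalCLM_apply norm_coordFn_le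
  norm_fderiv_apply_le)

variable {A : Type*}

/-! ## §0 The rate inequality: positivity of an admissible rate, and three suppliers -/

/-- An admissible rate is POSITIVE (the rate inequality at `ρ = 0`, unit ball): `0 ≤ c̄`, `0 < ρ₄`, `c̄ + ρ₄ < 1` and
`ρ₄² − ρ² ≤ μ·ρ₄·(1 − (c̄ + ρ)²)` on `[0, ρ₄]` force `0 < μ`. [folklore] -/
theorem rate_pos_unit {cbar ρ₄ μ : ℝ} (hcbar : 0 ≤ cbar) (hρ₄ : 0 < ρ₄) (h1 : cbar + ρ₄ < 1)
    (hμ : ∀ ρ ∈ Icc (0 : ℝ) ρ₄, ρ₄ ^ 2 - ρ ^ 2 ≤ μ * ρ₄ * (1 - (cbar + ρ) ^ 2)) : 0 < μ := by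
  have h := hμ 0 ⟨le_rfl, hρ₄.le⟩
  simp only [add_zero] at h
  have h1c : 0 < 1 - cbar ^ 2 := by nlinarith
  by_contra hle
  have hle' : μ ≤ 0 := not_lt.1 hle
  nlinarith [mul_nonneg (neg_nonneg.2 hle') (mul_pos hρ₄ h1c).le, pow_pos hρ₄ 2]

/-- An admissible rate is POSITIVE (radius `r`): `0 ≤ c̄`, `0 < r₄`, `c̄ + r₄ < r` and
`(r₄² − ρ²)·r ≤ μ·r₄·(r² − (c̄ + ρ)²)` on `[0, r₄]` force `0 < μ`. [folklore] -/
theorem rate_pos {r cbar r₄ μ : ℝ} (hr : 0 < r) (hcbar : 0 ≤ cbar) (hr₄ : 0 < r₄) (h1 : cbar + r₄ < r)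
    (hμ : ∀ ρ ∈ Icc (0 : ℝ) r₄, (r₄ ^ 2 - ρ ^ 2) * r ≤ μ * r₄ * (r ^ 2 - (cbar + ρ) ^ 2)) : 0 < μ := by
  have h := hμ 0 ⟨le_rfl, hr₄.le⟩
  simp only [add_zero] at h
  have h1c : 0 < r ^ 2 - cbar ^ 2 := by nlinarith
  by_contra hle
  have hle' : μ ≤ 0 := not_lt.1 hle
  nlinarith [mul_nonneg (neg_nonneg.2 hle') (mul_pos hr₄ h1c).le, mul_pos (pow_pos hr₄ 2) hr]

/-- CRUDE ADMISSIBLE RATE (closed form): `μ₀ := r₄·r ∕ (r² − (c̄ + r₄)²)` satisfies the rate inequality for `(r, c̄, r₄)`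
whenever `0 ≤ c̄`, `0 ≤ r₄`, `c̄ + r₄ < r` (bound `ρ²` below by `0` and `(c̄ + ρ)²` above by `(c̄ + r₄)²`).  At `c̄ + r₄ = θr`
this is `(r₄∕r)∕(1 − θ²)`. [folklore] -/
theorem rateIneq_crude {r cbar r₄ : ℝ} (hr : 0 < r) (hcbar : 0 ≤ cbar) (hr₄ : 0 ≤ r₄) (h1 : cbar + r₄ < r) :
    ∀ ρ ∈ Icc (0 : ℝ) r₄,
      (r₄ ^ 2 - ρ ^ 2) * r ≤ r₄ * r / (r ^ 2 - (cbar + r₄) ^ 2) * r₄ * (r ^ 2 - (cbar + ρ) ^ 2) := by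
  intro ρ hρ
  have hD : 0 < r ^ 2 - (cbar + r₄) ^ 2 := by nlinarith
  have hle1 : (r₄ ^ 2 - ρ ^ 2) * r ≤ r₄ ^ 2 * r := by nlinarith [sq_nonneg ρ]
  have hle2 : r ^ 2 - (cbar + r₄) ^ 2 ≤ r ^ 2 - (cbar + ρ) ^ 2 := by nlinarith [hρ.1, hρ.2]
  rw [div_mul_eq_mul_div, div_mul_eq_mul_div, le_div_iff₀ hD]
  calc (r₄ ^ 2 - ρ ^ 2) * r * (r ^ 2 - (cbar + r₄) ^ 2) ≤ r₄ ^ 2 * r * (r ^ 2 - (cbar + ρ) ^ 2) :=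
        mul_le_mul hle1 hle2 hD.le (by positivity)
    _ = r₄ * r * r₄ * (r ^ 2 - (cbar + ρ) ^ 2) := by ring

/-- CENTRED CASE: for `c̄ = 0`, `r₄ = θr` (`0 ≤ θ < 1`) the rate `μ = θ` is admissible — so
`NE9PolydiscChain.chainLipschitz_of_holoSelfMaps_polydisc` (centred images `B̄(0,θr)`, constants `(1/(1−θ²), θ)`) is the special case
`c k g = 0` of `chainLipschitz_of_holoMaps_offCentre`. [folklore] -/
theorem rateIneq_centred {r θ : ℝ} (hr : 0 < r) (hθ0 : 0 ≤ θ) (hθ1 : θ < 1) :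
    ∀ ρ ∈ Icc (0 : ℝ) (θ * r), ((θ * r) ^ 2 - ρ ^ 2) * r ≤ θ * (θ * r) * (r ^ 2 - (0 + ρ) ^ 2) := by
  intro ρ _
  rw [zero_add]
  have h1 : 0 ≤ 1 - θ ^ 2 := by nlinarith
  nlinarith [mul_nonneg (mul_nonneg (sq_nonneg ρ) hr.le) h1]

/-- COMPLETING THE SQUARE — the planner `t4-ne9-idea-1` generation 9's `pointwise_of_quadTest` (scratch
`t4/ideate/NE9/lens1-NE9OffCentreChain.lean` sha16 409b85d4eb69d683 §0, VERBATIM): `λt′ < 1` and the QUADRATIC TEST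
`(λt′c̄)² ≤ (λt′(1 − c̄²) − t′²)(1 − λt′)` give `t′² − ρ² ≤ λ·t′·(1 − (c̄ + ρ)²)` for EVERY real `ρ` — a discriminant
certificate for the rate inequality, decidable by `norm_num` at rational letters. [folklore] -/
theorem pointwise_of_quadTest {t' cb lam : ℝ} (hlt : lam * t' < 1)
    (hquad : (lam * t' * cb) ^ 2 ≤ (lam * t' * (1 - cb ^ 2) - t' ^ 2) * (1 - lam * t')) (ρ : ℝ) :
    t' ^ 2 - ρ ^ 2 ≤ lam * t' * (1 - (cb + ρ) ^ 2) := by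
  have h1 : 0 < 1 - lam * t' := sub_pos.2 hlt
  have hid : (1 - lam * t') * (lam * t' * (1 - (cb + ρ) ^ 2) - (t' ^ 2 - ρ ^ 2)) =
      ((1 - lam * t') * ρ - lam * t' * cb) ^ 2 + ((lam * t' * (1 - cb ^ 2) - t' ^ 2) * (1 - lam * t') -
        (lam * t' * cb) ^ 2) := by ring
  have hnn : 0 ≤ (1 - lam * t') * (lam * t' * (1 - (cb + ρ) ^ 2) - (t' ^ 2 - ρ ^ 2)) := by
    rw [hid]; nlinarith [sq_nonneg ((1 - lam * t') * ρ - lam * t' * cb)]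
  have := le_of_mul_le_mul_left (by simpa using hnn : (1 - lam * t') * 0 ≤ _) h1
  linarith

/-- THE QUADRATIC TEST SUPPLIES THE RATE INEQUALITY: the planner's test at `(c̄, t′, λ)` with `0 < t ≤ t′` gives the rate
inequality for `(r, c̄·r, t·r)` at the rate `λ` (the previous lemma at `σ = ρ∕r`, radius monotonicity
`(t² − σ²)∕t ≤ (t′² − σ²)∕t′`, homogeneity) — so the planner's ∃-form kernel §5 is `NE9PolydiscChainOffCentre.
chainLipschitz_of_offCentreMaps_polydisc` fed by this lemma. [folklore] -/
theorem rateIneq_of_quadTest {r t t' cb lam : ℝ} (hr : 0 < r) (ht : 0 < t) (htt' : t ≤ t') (hlt : lam * t' < 1)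
    (hquad : (lam * t' * cb) ^ 2 ≤ (lam * t' * (1 - cb ^ 2) - t' ^ 2) * (1 - lam * t')) :
    ∀ ρ ∈ Icc (0 : ℝ) (t * r), ((t * r) ^ 2 - ρ ^ 2) * r ≤ lam * (t * r) * (r ^ 2 - (cb * r + ρ) ^ 2) := by
  intro ρ _
  have ht' : 0 < t' := lt_of_lt_of_le ht htt'
  set σ : ℝ := ρ / r with hσ
  have hρ : ρ = σ * r := by rw [hσ, div_mul_cancel₀ _ hr.ne']
  have h1 := pointwise_of_quadTest hlt hquad σ
  have h2 : t' * (t ^ 2 - σ ^ 2) ≤ t * (t' ^ 2 - σ ^ 2) := by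
    nlinarith [mul_nonneg (sub_nonneg.2 htt') (add_nonneg (mul_nonneg ht.le ht'.le) (sq_nonneg σ))]
  have h3 : t ^ 2 - σ ^ 2 ≤ lam * t * (1 - (cb + σ) ^ 2) := by
    have h4 : t' * (t ^ 2 - σ ^ 2) ≤ t' * (lam * t * (1 - (cb + σ) ^ 2)) := by
      calc t' * (t ^ 2 - σ ^ 2) ≤ t * (t' ^ 2 - σ ^ 2) := h2
        _ ≤ t * (lam * t' * (1 - (cb + σ) ^ 2)) := mul_le_mul_of_nonneg_left h1 ht.le
        _ = t' * (lam * t * (1 - (cb + σ) ^ 2)) := by ring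
    exact le_of_mul_le_mul_left h4 ht'
  have h5 : r ^ 3 * (t ^ 2 - σ ^ 2) ≤ r ^ 3 * (lam * t * (1 - (cb + σ) ^ 2)) :=
    mul_le_mul_of_nonneg_left h3 (pow_pos hr 3).le
  calc ((t * r) ^ 2 - ρ ^ 2) * r = r ^ 3 * (t ^ 2 - σ ^ 2) := by rw [hρ]; ring
    _ ≤ r ^ 3 * (lam * t * (1 - (cb + σ) ^ 2)) := h5
    _ = lam * (t * r) * (r ^ 2 - (cb * r + ρ) ^ 2) := by rw [hρ]; ring

/-! ## §1 The infinitesimal polydisc Schwarz–Pick lemma at the sharp radius -/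

/-- **INFINITESIMAL POLYDISC SCHWARZ–PICK, SHARP RADIUS.**  Let `h : B_{ℓ^∞(A)}(0,1) → B̄_𝔉(0,s)` be holomorphic (`0 < s`),
`π : 𝔉 →L[ℂ] ℂ` with `‖π y‖ ≤ ‖y‖`, `x ∈ B(0,1)`, and `v` with `|v_α| ≤ C·(1 − |x_α|²)` for all `α` (`C ≥ 0`).  Then
`s·|π(Dh(x)v)| ≤ C·(s² − |π(h x)|²)`.  Proof: `NE9PolydiscSchwarzPick.norm_fderiv_apply_le` at `θ′ = 1` for `t⁻¹ • h : B(0,1) → B̄(0,s∕t)`,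
every `t > s`, then `t ↓ s`. [folklore; FV1980] -/
theorem mul_norm_fderiv_apply_le {𝔉 : Type*} [NormedAddCommGroup 𝔉] [NormedSpace ℂ 𝔉] (π : 𝔉 →L[ℂ] ℂ)
    (hπ : ∀ y, ‖π y‖ ≤ ‖y‖) {s : ℝ} (hs : 0 < s)
    {h : lp (fun _ : A => ℂ) ∞ → 𝔉} (hh : DifferentiableOn ℂ h (ball 0 1))
    (hhm : MapsTo h (ball 0 1) (closedBall 0 s)) {x : lp (fun _ : A => ℂ) ∞}
    (hx : x ∈ ball (0 : lp (fun _ : A => ℂ) ∞) 1) (v : lp (fun _ : A => ℂ) ∞) {C : ℝ} (hC : 0 ≤ C)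
    (hv : ∀ α, ‖v α‖ ≤ C * (1 - ‖x α‖ ^ 2)) :
    s * ‖π (fderiv ℂ h x v)‖ ≤ C * (s ^ 2 - ‖π (h x)‖ ^ 2) := by
  have hdiff : DifferentiableAt ℂ h x := hh.differentiableAt (isOpen_ball.mem_nhds hx)
  -- for every `t > s`: the scaled map `t⁻¹ • h` maps the ball into `B̄(0, s/t)`, `s/t < 1`
  have key : ∀ t : ℝ, s < t → t * ‖π (fderiv ℂ h x v)‖ ≤ C * (t ^ 2 - ‖π (h x)‖ ^ 2) := by
    intro t hst
    have ht : 0 < t := hs.trans hst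
    have hnt : ∀ w : 𝔉, ‖π ((t : ℂ)⁻¹ • w)‖ = t⁻¹ * ‖π w‖ := fun w => by
      rw [map_smul, norm_smul, norm_inv, Complex.norm_of_nonneg ht.le]
    have hd : DifferentiableOn ℂ (fun z => (t : ℂ)⁻¹ • h z) (ball (0 : lp (fun _ : A => ℂ) ∞) 1) :=
      hh.const_smul ((t : ℂ)⁻¹)
    have hm : MapsTo (fun z => (t : ℂ)⁻¹ • h z) (ball (0 : lp (fun _ : A => ℂ) ∞) 1) (closedBall 0 (s / t)) := by
      intro z hz
      have h1 := mem_closedBall_zero_iff.1 (hhm hz)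
      rw [mem_closedBall_zero_iff, norm_smul, norm_inv, Complex.norm_of_nonneg ht.le, div_eq_inv_mul]
      exact mul_le_mul_of_nonneg_left h1 (inv_nonneg.2 ht.le)
    have step := norm_fderiv_apply_le π hπ (div_nonneg hs.le ht.le) ((div_lt_one ht).2 hst) le_rfl hd hm hx v hC hv
    have hfd : fderiv ℂ (fun z => (t : ℂ)⁻¹ • h z) x v = (t : ℂ)⁻¹ • fderiv ℂ h x v := by
      rw [fderiv_fun_const_smul hdiff]; rfl
    rw [hfd, hnt, hnt, one_mul] at step
    have ht2 : 0 < t ^ 2 := pow_pos ht 2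
    have step2 := mul_le_mul_of_nonneg_left step ht2.le
    calc t * ‖π (fderiv ℂ h x v)‖ = t ^ 2 * (t⁻¹ * ‖π (fderiv ℂ h x v)‖) := by field_simp
      _ ≤ t ^ 2 * (C * (1 - (t⁻¹ * ‖π (h x)‖) ^ 2)) := step2
      _ = C * (t ^ 2 - ‖π (h x)‖ ^ 2) := by field_simp
  -- `t ↓ s`
  have hcont1 : Tendsto (fun t : ℝ => t * ‖π (fderiv ℂ h x v)‖) (𝓝[>] s) (𝓝 (s * ‖π (fderiv ℂ h x v)‖)) :=
    ((continuous_id.mul continuous_const).tendsto s).mono_left nhdsWithin_le_nhds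
  have hcont2 : Tendsto (fun t : ℝ => C * (t ^ 2 - ‖π (h x)‖ ^ 2)) (𝓝[>] s)
      (𝓝 (C * (s ^ 2 - ‖π (h x)‖ ^ 2))) :=
    ((continuous_const.mul ((continuous_pow 2).sub continuous_const)).tendsto s).mono_left nhdsWithin_le_nhds
  have hev : ∀ᶠ t in 𝓝[>] s, t * ‖π (fderiv ℂ h x v)‖ ≤ C * (t ^ 2 - ‖π (h x)‖ ^ 2) := by
    filter_upwards [self_mem_nhdsWithin] with t ht using key t ht
  exact le_of_tendsto_of_tendsto hcont1 hcont2 hev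

/-! ## §2 One step with an off-centre image -/

/-- **ONE STEP, OFF-CENTRE IMAGE.**  Let `f : B_{ℓ^∞(A)}(0,1) → B̄_𝔉(c, ρ₄)` be holomorphic, `‖c‖ ≤ c̄`, `0 < ρ₄`,
`c̄ + ρ₄ < 1`, `π : 𝔉 →L[ℂ] ℂ` with `‖π y‖ ≤ ‖y‖`, and let the number `μ` satisfy the RATE INEQUALITY
`ρ₄² − ρ² ≤ μ·ρ₄·(1 − (c̄ + ρ)²)` for all `ρ ∈ [0, ρ₄]`.  If `|v_α| ≤ C·(1 − |x_α|²)` for all `α` (`C ≥ 0`) then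
`|π(Df(x)v)| ≤ μ·C·(1 − |π(f x)|²)`.  Proof: §1 for `h = f − c` at radius `ρ₄` gives `ρ₄·|π(Df v)| ≤ C(ρ₄² − ρ²)` with
`ρ = |π(f x) − π c| ∈ [0, ρ₄]`; the rate inequality and `|π(f x)| ≤ c̄ + ρ` finish.  (The refuter's
«K(f z; Df·v) ≤ λ*·K(z; v)», PRICING-NE9 v10 (E10-1): `λ*` = the least admissible `μ`.) [folklore; FV1980] -/
theorem norm_fderiv_apply_le_offCentre {𝔉 : Type*} [NormedAddCommGroup 𝔉] [NormedSpace ℂ 𝔉] (π : 𝔉 →L[ℂ] ℂ)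
    (hπ : ∀ y, ‖π y‖ ≤ ‖y‖) {cbar ρ₄ μ : ℝ} (hρ₄ : 0 < ρ₄) (h1 : cbar + ρ₄ < 1)
    (hμ : ∀ ρ ∈ Icc (0 : ℝ) ρ₄, ρ₄ ^ 2 - ρ ^ 2 ≤ μ * ρ₄ * (1 - (cbar + ρ) ^ 2))
    {f : lp (fun _ : A => ℂ) ∞ → 𝔉} (hf : DifferentiableOn ℂ f (ball 0 1)) {c : 𝔉}
    (hfm : MapsTo f (ball 0 1) (closedBall c ρ₄)) (hc : ‖c‖ ≤ cbar) {x : lp (fun _ : A => ℂ) ∞}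
    (hx : x ∈ ball (0 : lp (fun _ : A => ℂ) ∞) 1) (v : lp (fun _ : A => ℂ) ∞) {C : ℝ} (hC : 0 ≤ C)
    (hv : ∀ α, ‖v α‖ ≤ C * (1 - ‖x α‖ ^ 2)) :
    ‖π (fderiv ℂ f x v)‖ ≤ μ * C * (1 - ‖π (f x)‖ ^ 2) := by
  have hcbar : 0 ≤ cbar := (norm_nonneg c).trans hc
  have hμ0 : 0 < μ := rate_pos_unit hcbar hρ₄ h1 hμ
  -- the centred map `g = f − c : B(0,1) → B̄(0,ρ₄)`
  set g : lp (fun _ : A => ℂ) ∞ → 𝔉 := fun z => f z - c with hg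
  have hgd : DifferentiableOn ℂ g (ball (0 : lp (fun _ : A => ℂ) ∞) 1) := hf.sub_const c
  have hgm : MapsTo g (ball (0 : lp (fun _ : A => ℂ) ∞) 1) (closedBall 0 ρ₄) := fun z hz => by
    have h2 := hfm hz
    rw [mem_closedBall, dist_eq_norm] at h2
    exact mem_closedBall_zero_iff.2 h2
  have hA := mul_norm_fderiv_apply_le π hπ hρ₄ hgd hgm hx v hC hv
  have hfd : fderiv ℂ g x = fderiv ℂ f x := by rw [hg, fderiv_sub_const]
  rw [hfd] at hA
  -- `ρ := |π(f x − c)| ∈ [0, ρ₄]`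
  set ρ : ℝ := ‖π (g x)‖ with hρ
  have hρ1 : ρ ≤ ρ₄ := (hπ _).trans (mem_closedBall_zero_iff.1 (hgm hx))
  have hq := hμ ρ ⟨norm_nonneg _, hρ1⟩
  -- `|π(f x)| ≤ c̄ + ρ < 1`
  have hfx : ‖π (f x)‖ ≤ cbar + ρ := by
    have h3 : π (f x) = π c + π (g x) := by simp only [hg, map_sub]; ring
    calc ‖π (f x)‖ = ‖π c + π (g x)‖ := by rw [h3]
      _ ≤ ‖π c‖ + ‖π (g x)‖ := norm_add_le _ _
      _ ≤ cbar + ρ := add_le_add ((hπ c).trans hc) le_rfl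
  have hsq : ‖π (f x)‖ ^ 2 ≤ (cbar + ρ) ^ 2 := pow_le_pow_left₀ (norm_nonneg _) hfx 2
  have h3 : ρ₄ * ‖π (fderiv ℂ f x v)‖ ≤ ρ₄ * (μ * C * (1 - ‖π (f x)‖ ^ 2)) := by
    calc ρ₄ * ‖π (fderiv ℂ f x v)‖ ≤ C * (ρ₄ ^ 2 - ρ ^ 2) := hA
      _ ≤ C * (μ * ρ₄ * (1 - (cbar + ρ) ^ 2)) := mul_le_mul_of_nonneg_left hq hC
      _ ≤ C * (μ * ρ₄ * (1 - ‖π (f x)‖ ^ 2)) :=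
          mul_le_mul_of_nonneg_left (mul_le_mul_of_nonneg_left (by linarith) (mul_pos hμ0 hρ₄).le) hC
      _ = ρ₄ * (μ * C * (1 - ‖π (f x)‖ ^ 2)) := by ring
  exact le_of_mul_le_mul_left h3 hρ₄

/-! ## §3 The chain estimate on `ℓ^∞(A;ℂ)`, unit ball -/

/-- An off-centre image ball with `‖c‖ ≤ c̄`, `c̄ + ρ₄ ≤ R` lies in the centred ball `B̄(0,R)`. [folklore] -/
theorem mapsTo_closedBall_zero_of_offCentre {𝔛 𝔉 : Type*} [NormedAddCommGroup 𝔉] {D : Set 𝔛} {f : 𝔛 → 𝔉} {c : 𝔉}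
    {cbar ρ₄ R : ℝ} (hfm : MapsTo f D (closedBall c ρ₄)) (hc : ‖c‖ ≤ cbar) (hR : cbar + ρ₄ ≤ R) :
    MapsTo f D (closedBall 0 R) := fun z hz => by
  have h2 := hfm hz
  rw [mem_closedBall, dist_eq_norm] at h2
  rw [mem_closedBall_zero_iff]
  calc ‖f z‖ = ‖c + (f z - c)‖ := by congr 1; abel
    _ ≤ ‖c‖ + ‖f z - c‖ := norm_add_le _ _
    _ ≤ cbar + ρ₄ := add_le_add hc h2
    _ ≤ R := hR

/-- THE CHAIN on `ℓ^∞(A;ℂ)`, unit ball, OFF-CENTRE IMAGES: composites of holomorphic maps `B(0,1) → B̄(c_n, ρ₄)` with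
`‖c_n‖ ≤ c̄`, `c̄ + ρ₄ ≤ θ < 1` and an admissible rate `μ` are `(1/(1−θ²))·μⁿ`-Lipschitz on `B̄(0,θ)` (`NE9PolydiscChain`'s
structure (a)–(d), with §2 in the inductive step (b)). [folklore] -/
theorem norm_sub_le_of_holoChain_offCentre_unit {θ cbar ρ₄ μ : ℝ} (hρ₄ : 0 < ρ₄) (hθ : cbar + ρ₄ ≤ θ) (hθ1 : θ < 1)
    (hμ : ∀ ρ ∈ Icc (0 : ℝ) ρ₄, ρ₄ ^ 2 - ρ ^ 2 ≤ μ * ρ₄ * (1 - (cbar + ρ) ^ 2))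
    {f : ℕ → lp (fun _ : A => ℂ) ∞ → lp (fun _ : A => ℂ) ∞}
    (hfd : ∀ n, DifferentiableOn ℂ (f n) (ball (0 : lp (fun _ : A => ℂ) ∞) 1))
    {c : ℕ → lp (fun _ : A => ℂ) ∞}
    (hfm : ∀ n, MapsTo (f n) (ball (0 : lp (fun _ : A => ℂ) ∞) 1) (closedBall (c n) ρ₄))
    (hc : ∀ n, ‖c n‖ ≤ cbar)
    {T : ℕ → lp (fun _ : A => ℂ) ∞ → lp (fun _ : A => ℂ) ∞} (hT0 : T 0 = id)
    (hT : ∀ n, T (n + 1) = f n ∘ T n) (n : ℕ) {x y : lp (fun _ : A => ℂ) ∞}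
    (hx : x ∈ closedBall (0 : lp (fun _ : A => ℂ) ∞) θ) (hy : y ∈ closedBall (0 : lp (fun _ : A => ℂ) ∞) θ) :
    ‖T n x - T n y‖ ≤ 1 / (1 - θ ^ 2) * μ ^ n * ‖x - y‖ := by
  have hcbar : 0 ≤ cbar := (norm_nonneg (c 0)).trans (hc 0)
  have hcr1 : cbar + ρ₄ < 1 := lt_of_le_of_lt hθ hθ1
  have hμ0 : 0 < μ := rate_pos_unit hcbar hρ₄ hcr1 hμ
  have h1θ : 0 < 1 - θ ^ 2 := by nlinarith
  have hsub : closedBall (0 : lp (fun _ : A => ℂ) ∞) θ ⊆ ball 0 1 := closedBall_subset_ball hθ1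
  have hfm' : ∀ n, MapsTo (f n) (ball (0 : lp (fun _ : A => ℂ) ∞) 1) (closedBall 0 θ) := fun n =>
    mapsTo_closedBall_zero_of_offCentre (hfm n) (hc n) hθ
  -- (a) the composites keep the inner ball
  have hmem : ∀ n, ∀ z ∈ closedBall (0 : lp (fun _ : A => ℂ) ∞) θ,
      T n z ∈ closedBall (0 : lp (fun _ : A => ℂ) ∞) θ := by
    intro n
    induction n with
    | zero => intro z hz; simpa [hT0] using hz
    | succ n ih => intro z hz; rw [hT n]; exact hfm' n (hsub (ih z hz))
  -- (b) derivative of the composite + transfer of the polydisc bound along the chain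
  have hder : ∀ n, ∀ z ∈ closedBall (0 : lp (fun _ : A => ℂ) ∞) θ,
      HasFDerivAt (T n) (fderiv ℂ (T n) z) z ∧
      ∀ (w : lp (fun _ : A => ℂ) ∞) (β : A),
        ‖(fderiv ℂ (T n) z w) β‖ ≤ μ ^ n * (‖w‖ / (1 - θ ^ 2)) * (1 - ‖(T n z) β‖ ^ 2) := by
    intro n
    induction n with
    | zero =>
      intro z hz
      have hz' : ‖z‖ ≤ θ := mem_closedBall_zero_iff.1 hz
      refine ⟨?_, ?_⟩
      · rw [hT0, fderiv_id]; exact hasFDerivAt_id z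
      · intro w β
        rw [hT0, fderiv_id]
        simp only [ContinuousLinearMap.coe_id', id_eq, pow_zero, one_mul]
        have hzβ : ‖z β‖ ≤ θ := (norm_coordFn_le z β).trans hz'
        have h1 : 1 - θ ^ 2 ≤ 1 - ‖z β‖ ^ 2 := by nlinarith [norm_nonneg (z β)]
        calc ‖w β‖ ≤ ‖w‖ := norm_coordFn_le w β
          _ = ‖w‖ / (1 - θ ^ 2) * (1 - θ ^ 2) := (div_mul_cancel₀ _ h1θ.ne').symm
          _ ≤ ‖w‖ / (1 - θ ^ 2) * (1 - ‖z β‖ ^ 2) :=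
            mul_le_mul_of_nonneg_left h1 (div_nonneg (norm_nonneg w) h1θ.le)
    | succ n ih =>
      intro z hz
      obtain ⟨hTn, hbound⟩ := ih z hz
      have hTnz : T n z ∈ ball (0 : lp (fun _ : A => ℂ) ∞) 1 := hsub (hmem n z hz)
      have hfn : HasFDerivAt (f n) (fderiv ℂ (f n) (T n z)) (T n z) :=
        ((hfd n).differentiableAt (isOpen_ball.mem_nhds hTnz)).hasFDerivAt
      have hcomp : HasFDerivAt (T (n + 1)) ((fderiv ℂ (f n) (T n z)).comp (fderiv ℂ (T n) z)) z := by
        rw [hT n]; exact hfn.comp z hTn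
      refine ⟨hcomp.differentiableAt.hasFDerivAt, ?_⟩
      intro w β
      have hTsucc : T (n + 1) z = f n (T n z) := by rw [hT n]; rfl
      rw [hcomp.fderiv, ContinuousLinearMap.comp_apply, hTsucc]
      have hC : 0 ≤ μ ^ n * (‖w‖ / (1 - θ ^ 2)) :=
        mul_nonneg (pow_nonneg hμ0.le n) (div_nonneg (norm_nonneg w) h1θ.le)
      have key := norm_fderiv_apply_le_offCentre (lp.evalCLM ℂ (fun _ : A => ℂ) ∞ β) (fun u => norm_coordFn_le u β)
        hρ₄ hcr1 hμ (hfd n) (hfm n) (hc n) hTnz (fderiv ℂ (T n) z w) hC (fun α => hbound w α)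
      simp only [evalCLM_apply] at key
      calc ‖(fderiv ℂ (f n) (T n z) (fderiv ℂ (T n) z w)) β‖
          ≤ μ * (μ ^ n * (‖w‖ / (1 - θ ^ 2))) * (1 - ‖(f n (T n z)) β‖ ^ 2) := key
        _ = μ ^ (n + 1) * (‖w‖ / (1 - θ ^ 2)) * (1 - ‖(f n (T n z)) β‖ ^ 2) := by rw [pow_succ]; ring
  -- (c) operator-norm bound of the derivative on the inner ball
  have hop : ∀ z ∈ closedBall (0 : lp (fun _ : A => ℂ) ∞) θ, ‖fderiv ℂ (T n) z‖ ≤ 1 / (1 - θ ^ 2) * μ ^ n := by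
    intro z hz
    obtain ⟨-, hbound⟩ := hder n z hz
    have hK : 0 ≤ 1 / (1 - θ ^ 2) * μ ^ n := mul_nonneg (one_div_nonneg.2 h1θ.le) (pow_nonneg hμ0.le n)
    refine ContinuousLinearMap.opNorm_le_bound _ hK fun w => ?_
    have hCw : 0 ≤ μ ^ n * (‖w‖ / (1 - θ ^ 2)) :=
      mul_nonneg (pow_nonneg hμ0.le n) (div_nonneg (norm_nonneg w) h1θ.le)
    have hle : ∀ β, ‖(fderiv ℂ (T n) z w) β‖ ≤ μ ^ n * (‖w‖ / (1 - θ ^ 2)) := fun β => by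
      have h1 : 1 - ‖(T n z) β‖ ^ 2 ≤ 1 := by nlinarith [norm_nonneg ((T n z) β)]
      calc ‖(fderiv ℂ (T n) z w) β‖ ≤ μ ^ n * (‖w‖ / (1 - θ ^ 2)) * (1 - ‖(T n z) β‖ ^ 2) := hbound w β
        _ ≤ μ ^ n * (‖w‖ / (1 - θ ^ 2)) * 1 := mul_le_mul_of_nonneg_left h1 hCw
        _ = μ ^ n * (‖w‖ / (1 - θ ^ 2)) := mul_one _
    calc ‖fderiv ℂ (T n) z w‖ ≤ μ ^ n * (‖w‖ / (1 - θ ^ 2)) := lp.norm_le_of_forall_le hCw hle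
      _ = 1 / (1 - θ ^ 2) * μ ^ n * ‖w‖ := by ring
  -- (d) mean-value inequality on the convex inner ball
  exact (convex_closedBall (0 : lp (fun _ : A => ℂ) ∞) θ).norm_image_sub_le_of_norm_hasFDerivWithin_le
    (f := T n) (f' := fun z => fderiv ℂ (T n) z) (fun z hz => (hder n z hz).1.hasFDerivWithinAt) hop hy hx

end Summit.QuantumFields.BalabanUV.T4Continuum.NE9PolydiscStepOffCentre

end
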